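import Mathlib
import Literature.MathematicalPhysics.QuantumLattice.HubbardWave0
import HarnessLib

/-!
# Second-order effective Hamiltonians and the `O(t'²)` couplings of cluster pair bosons

Definition request `clusterPairBosonCouplings` (route SpinOnePairBoson of HubbardSuperconductivity,
support item `SopAdmissibleCouplings`; reusable by the Schrieffer–Wolff glue of route
PlaquetteBoson). Three layers, all for finite matrices over `ℂ` ("operators are matrices"):

1. **Second-order degenerate perturbation theory** for `H₀ : Matrix n n ℂ`, an unperturbed energy
   `E` and a perturbation `V`: Kato's reduced resolvent `reducedResolvent H₀ E = (H₀ − E)⁻¹ (1 − P)`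
   (Kato 1966, I-§5.3, (5.26)–(5.32)), the eigenprojection `eigenProj H₀ E = P`, and
   `secondOrderEffective H₀ V E = P V (E − H₀)⁻¹ (1 − P) V P = −P V S V P` (Kato 1966, II-§2.2
   (2.20) with `P T⁽¹⁾ P = 0`, `T⁽²⁾ = 0`; Tsai–Kivelson 2006, App. A (A1)). `S` and `P` are
   functional calculi of `H₀` (every real function is continuous on the finite spectrum of a
   matrix), and Kato's identities `S P = P S = 0`, `(H₀ − E) S = 1 − P`, `P² = P` are proved.
2. **The two-body resolvent kernel** `pairResolvent hA E a b c d =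
   Σ_{μ,ν} ⟨a,u_μ⟩⟨u_μ,b⟩⟨c,u_ν⟩⟨u_ν,d⟩ / (λ_μ + λ_ν − E)` over Mathlib's orthonormal eigenbasis of
   ONE Hermitian matrix `A`: the element `⟨a ⊗ c| (A ⊗ 1 + 1 ⊗ A − E)⁻¹_red |b ⊗ d⟩` of the
   reduced resolvent of two decoupled copies of `A`, written without tensor products (terms with
   `λ_μ + λ_ν = E` drop out through `0⁻¹ = 0`, the reduced-resolvent convention; the value only
   involves the spectral projections of `A`, not the choice of eigenbasis).
3. **Cluster pair bosons.** For a finite fermionic cluster (orbitals `ι`, Jordan–Wigner Fock space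
   `Fock ι` of `HubbardWave0`, Hermitian cluster Hamiltonian `H`), cluster states `φ : K → Fock ι`
   and real inter-cluster hoppings `W i j` (`V = −Σ W i j (c†_i c'_j + h.c.)`, the `t'²` factored
   out), `interClusterKernel hH φ W κ' κ` is the one-cluster formula for
   `⟨φ_{κ'.1} ⊗ φ_{κ'.2}| V (E − H₀)⁻¹_red V |φ_{κ.1} ⊗ φ_{κ.2}⟩`, `H₀ = H ⊗ 1 + 1 ⊗ H`: the four
   orderings of the two hops as `pairResolvent`s, the inter-cluster Jordan–Wigner string
   `c'_j = (−1)^{N₁} ⊗ c_j` giving the two pair-transfer orderings the sign `+1/(λ+λ'−E)` and the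
   two out-and-back orderings `−1/(λ+λ'−E)`. `clusterPairBosonCouplings hH φ B` specialises to
   Hubbard orbitals `Orb Λ`, spin-diagonal unit hopping on boundary site pairs `B` and `K = Fin 3`
   (`0, 1, 2` hole pairs ↦ `S^z = −1, 0, 1`), naming the route's pseudospin-1 bond couplings
   `hA, hB, hB', hC` (correlated pair hoppings) and the diagonal table `V`, with the six-parameter
   decomposition `V n m = c₀ + f(sₙ+sₘ) + v sₙsₘ + g(sₙ²+sₘ²) + w_odd(sₙ²sₘ+sₙsₘ²) + w sₙ²sₘ²`
   (`PairBosonCouplings.table_eq`; `g` is the per-bond single-ion `D (S^z)²` coefficient) — the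
   `S = 1` version of the `O(t'²)` pair-boson models of Yao–Tsai–Kivelson 2007, eq. (2).

NOT here (deferred to a proofs file; no named facts introduced): Kato 1966, II-§2.3 Thm. 2.3 /
(2.41) (`secondOrderEffective` gives the `κ²`-splitting) and the identification of
`interClusterKernel` with `secondOrderEffective` of the two-cluster system on `Fock (ι ⊕ₗ ι)`
(via `jwEmbed` of `FermionEmbedding`).

Mathlib / tree search: `cfc` for Hermitian matrices (`Matrix.IsHermitian.cfc_eq`,
`Matrix.finite_real_spectrum`, `Set.Finite.continuousOn`), `Matrix.IsHermitian.eigenvectorBasis`,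
`eigenvalues`; no reduced resolvent / effective Hamiltonian / Schrieffer–Wolff vocabulary in
Mathlib or the tree (`lean search 'reducedResolvent|Schrieffer|effectiveHam'`). Tree objects
reused: `Fock`, `creation`, `annihilation`, `expect`, `Orb` (`HubbardWave0`).

References: T. Kato, *Perturbation theory for linear operators* (1966), I-§5.3, II-§2.2–2.3
[Kato1966]; W.-F. Tsai, S. A. Kivelson, PRB 73 (2006) 214510, App. A [TsaiKivelson2006]; H. Yao,
W.-F. Tsai, S. A. Kivelson, PRB 76 (2007) 161104, eq. (2) [YaoTsaiKivelson2007].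
-/

noncomputable section

namespace Literature.MathematicalPhysics.QuantumLattice

open Matrix

/-! ### Reduced resolvent, eigenprojection and the second-order effective Hamiltonian -/

section SecondOrder

variable {n : Type*} [Fintype n] [DecidableEq n]

/-- Kato's **reduced resolvent** `S(E)` of a (Hermitian) matrix `H₀` at the real energy `E`:
`(H₀ − E)⁻¹` on the eigenvectors with eigenvalue `≠ E` and `0` on the `E`-eigenspace, i.e.
`S = Σ_{λ ≠ E} (λ − E)⁻¹ P_λ` (Kato 1966, I-§5.3, (5.26)–(5.29) and (5.32), semisimple case).
Defined as the continuous functional calculus of `x ↦ (x − E)⁻¹` (Lean's `0⁻¹ = 0` kills the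
`E`-eigenspace); junk value `0` if `H₀` is not Hermitian. The physicists' `(E − H₀)⁻¹ (1 − P)` is
`−S(E)`. [cite: Kato1966, I-§5.3 (5.26)–(5.32)] -/
def reducedResolvent (H₀ : Matrix n n ℂ) (E : ℝ) : Matrix n n ℂ :=
  cfc (fun x : ℝ => (x - E)⁻¹) H₀

/-- The **eigenprojection** `P` of a (Hermitian) matrix `H₀` for the real number `E`: the
orthogonal projection onto `ker (H₀ − E)` (`0` if `E` is not an eigenvalue; junk value `0` if `H₀`
is not Hermitian), as the functional calculus of the indicator of `{E}`.
Kato 1966, I-§5.3 (eigenprojection `P_h`, (5.26)). [cite: Kato1966, I-§5.3 (5.26)] -/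
def eigenProj (H₀ : Matrix n n ℂ) (E : ℝ) : Matrix n n ℂ :=
  cfc (fun x : ℝ => if x = E then (1 : ℝ) else 0) H₀

/-- The **second-order effective Hamiltonian** of the perturbation `V` on the `E`-eigenspace of
`H₀` (second-order degenerate Rayleigh–Schrödinger / Schrieffer–Wolff / Kato reduction):
`P V (E − H₀)⁻¹ (1 − P) V P = −P V S(E) V P`. This is Kato's `T̃⁽²⁾` of II-(2.20) for
`T(κ) = H₀ + κ V` when there is no first-order splitting (`P V P = 0`), and eq. (A1) of
Tsai–Kivelson 2006 (App. A); by Kato 1966, II-§2.3, Thm. 2.3/(2.41) its eigenvalues on `P` give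
the `κ²`-coefficients of the perturbed eigenvalues issuing from `E`.
[cite: Kato1966, II-§2.2 (2.20)] -/
def secondOrderEffective (H₀ V : Matrix n n ℂ) (E : ℝ) : Matrix n n ℂ :=
  -(eigenProj H₀ E * V * reducedResolvent H₀ E * V * eigenProj H₀ E)

/-- Every real function is continuous on the (finite) real spectrum of a complex matrix, so the
continuous functional calculus of a Hermitian matrix applies to bare functions. [folklore] -/
theorem continuousOn_spectrum_real (H₀ : Matrix n n ℂ) (f : ℝ → ℝ) :
    ContinuousOn f (spectrum ℝ H₀) :=
  (Matrix.finite_real_spectrum (A := H₀)).continuousOn f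

/-- Kato's identity `S P = 0` (Kato 1966, I-(5.28)): the reduced resolvent annihilates the
eigenspace. [cite: Kato1966, I-§5.3 (5.28)] -/
theorem reducedResolvent_mul_eigenProj (H₀ : Matrix n n ℂ) (E : ℝ) :
    reducedResolvent H₀ E * eigenProj H₀ E = 0 := by
  rw [reducedResolvent, eigenProj, ← cfc_mul _ _ H₀ (continuousOn_spectrum_real H₀ _)
    (continuousOn_spectrum_real H₀ _)]
  convert cfc_zero ℝ H₀ using 2
  ext x
  by_cases hx : x = E <;> simp [hx]

/-- Kato's identity `P S = 0` (Kato 1966, I-(5.28)). [cite: Kato1966, I-§5.3 (5.28)] -/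
theorem eigenProj_mul_reducedResolvent (H₀ : Matrix n n ℂ) (E : ℝ) :
    eigenProj H₀ E * reducedResolvent H₀ E = 0 := by
  rw [reducedResolvent, eigenProj, ← cfc_mul _ _ H₀ (continuousOn_spectrum_real H₀ _)
    (continuousOn_spectrum_real H₀ _)]
  convert cfc_zero ℝ H₀ using 2
  ext x
  by_cases hx : x = E <;> simp [hx]

/-- The eigenprojection is idempotent, `P² = P` (Kato 1966, I-(5.21)). [cite: Kato1966, I-§5.3] -/
theorem eigenProj_mul_eigenProj (H₀ : Matrix n n ℂ) (E : ℝ) :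
    eigenProj H₀ E * eigenProj H₀ E = eigenProj H₀ E := by
  rw [eigenProj, ← cfc_mul _ _ H₀ (continuousOn_spectrum_real H₀ _)
    (continuousOn_spectrum_real H₀ _)]
  congr 1
  ext x
  by_cases hx : x = E <;> simp [hx]

/-- Kato's identity `(H₀ − E) S = 1 − P` for a Hermitian matrix (Kato 1966, I-(5.29) at `ζ = λ`):
`S(E)` inverts `H₀ − E` on the complement of the eigenspace. [cite: Kato1966, I-§5.3 (5.29)] -/
theorem sub_mul_reducedResolvent {H₀ : Matrix n n ℂ} (hH : H₀.IsHermitian) (E : ℝ) :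
    (H₀ - algebraMap ℝ _ E) * reducedResolvent H₀ E = 1 - eigenProj H₀ E := by
  have hsa : IsSelfAdjoint H₀ := hH
  have h1 : H₀ - algebraMap ℝ _ E = cfc (fun x : ℝ => x - E) H₀ := by
    rw [cfc_sub _ _ H₀ (continuousOn_spectrum_real H₀ _) (continuousOn_spectrum_real H₀ _),
      cfc_id' ℝ H₀, cfc_const E H₀]
  rw [h1, reducedResolvent, eigenProj, ← cfc_mul _ _ H₀ (continuousOn_spectrum_real H₀ _)
    (continuousOn_spectrum_real H₀ _), ← cfc_one ℝ H₀,
    ← cfc_sub _ _ H₀ (continuousOn_spectrum_real H₀ _) (continuousOn_spectrum_real H₀ _)]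
  congr 1
  ext x
  by_cases hx : x = E
  · simp [hx]
  · simp [hx, mul_inv_cancel₀ (sub_ne_zero.2 hx)]

/-- The reduced resolvent of a matrix at a real energy is Hermitian (a real functional calculus
is self-adjoint). [folklore] -/
theorem reducedResolvent_isHermitian (H₀ : Matrix n n ℂ) (E : ℝ) :
    (reducedResolvent H₀ E).IsHermitian :=
  (cfc_predicate (R := ℝ) (fun x : ℝ => (x - E)⁻¹) H₀ : IsSelfAdjoint _)

/-- The eigenprojection is Hermitian (an orthogonal projection). [folklore] -/
theorem eigenProj_isHermitian (H₀ : Matrix n n ℂ) (E : ℝ) : (eigenProj H₀ E).IsHermitian :=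
  (cfc_predicate (R := ℝ) (fun x : ℝ => if x = E then (1 : ℝ) else 0) H₀ : IsSelfAdjoint _)

end SecondOrder

/-! ### The two-body resolvent kernel over one-body eigendata -/

section PairResolvent

variable {n : Type*} [Fintype n] [DecidableEq n] {A : Matrix n n ℂ}

/-- The **two-body (pair) resolvent kernel** of a Hermitian matrix `A` at total energy `E`:
`Σ_{μ,ν} ⟨a,u_μ⟩⟨u_μ,b⟩ · ⟨c,u_ν⟩⟨u_ν,d⟩ / (λ_μ + λ_ν − E)` over Mathlib's orthonormal eigenbasis
`(u_μ, λ_μ)` of `A` (`⟨x,y⟩ = star x ⬝ᵥ y`). It is the matrix element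
`⟨a ⊗ c| (A ⊗ 1 + 1 ⊗ A − E)⁻¹_red |b ⊗ d⟩` of Kato's reduced resolvent (Kato 1966, I-(5.32)) of
two decoupled copies of `A` between product vectors, written without tensor products as a double
spectral sum ("sum over intermediate states", Tsai–Kivelson 2006, App. A); terms with
`λ_μ + λ_ν = E` are omitted through `0⁻¹ = 0`, and the value depends on `A` only through its
spectral projections (not on the choice of eigenbasis). [cite: Kato1966, I-§5.3 (5.32)] -/
def pairResolvent (hA : A.IsHermitian) (E : ℝ) (a b c d : n → ℂ) : ℂ :=
  ∑ μ, ∑ ν, (star a ⬝ᵥ ⇑(hA.eigenvectorBasis μ)) * (star ⇑(hA.eigenvectorBasis μ) ⬝ᵥ b) *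
    ((star c ⬝ᵥ ⇑(hA.eigenvectorBasis ν)) * (star ⇑(hA.eigenvectorBasis ν) ⬝ᵥ d)) *
      (((hA.eigenvalues μ + hA.eigenvalues ν - E : ℝ) : ℂ))⁻¹

/-- Conjugate symmetry of the pair resolvent kernel (the two-body reduced resolvent is Hermitian):
`conj K(E; a,b; c,d) = K(E; b,a; d,c)`. [folklore] -/
theorem star_pairResolvent (hA : A.IsHermitian) (E : ℝ) (a b c d : n → ℂ) :
    star (pairResolvent hA E a b c d) = pairResolvent hA E b a d c := by
  have hd : ∀ x y : n → ℂ, star (star x ⬝ᵥ y) = star y ⬝ᵥ x := fun x y => by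
    rw [star_dotProduct, star_star, dotProduct_comm]
  simp only [pairResolvent, star_sum, star_mul', star_inv₀, hd, Complex.star_def,
    Complex.conj_ofReal]
  exact Finset.sum_congr rfl fun μ _ => Finset.sum_congr rfl fun ν _ => by ring

end PairResolvent

/-! ### The inter-cluster second-order kernel for fermions -/

section InterCluster

variable {ι : Type*} [LinearOrder ι] [Fintype ι] {K : Type*}
  {H : Matrix (Finset ι) (Finset ι) ℂ}

/-- The (unperturbed) energy of the product state `φ_{κ.1} ⊗ φ_{κ.2}` of two decoupled copies of
the cluster: `Re ⟨φ_{κ.1}, H φ_{κ.1}⟩ + Re ⟨φ_{κ.2}, H φ_{κ.2}⟩` (for normalised eigenvectors, the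
sum of the two eigenvalues). [folklore] -/
def pairEnergy (H : Matrix (Finset ι) (Finset ι) ℂ) (φ : K → Fock ι) (κ : K × K) : ℝ :=
  (expect H (φ κ.1)).re + (expect H (φ κ.2)).re

/-- **Inter-cluster second-order kernel.** Two copies of a finite fermionic cluster (orbitals `ι`,
Hermitian cluster Hamiltonian `H`, `H₀ = H ⊗ 1 + 1 ⊗ H` on `Fock (ι ⊕ₗ ι)`), coupled by the unit
hopping `V = −Σ_{i,j} W i j (c†_i c'_j + c'†_j c_i)` (`c` on cluster 1, `c'` on cluster 2, `W`
real). For cluster states `φ : K → Fock ι`, `interClusterKernel hH φ W κ' κ` is the explicit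
ONE-cluster formula for the matrix element
`⟨φ_{κ'.1} ⊗ φ_{κ'.2}| V (E − H₀)⁻¹_red V |φ_{κ.1} ⊗ φ_{κ.2}⟩`, `E` = mean of the initial and
final `pairEnergy` (equal on an exactly degenerate manifold), i.e. the `(κ',κ)` entry of
`secondOrderEffective H₀ V E` between product states of particle-number eigenstates of a common
parity (the formal identification on `Fock (ι ⊕ₗ ι)` is deferred to the proofs file), expanded by
intermediate one-cluster eigenstates `μ` (cluster 1) and `ν` (cluster 2), `ε_μ + ε_ν − E > 0`
under a gap hypothesis:
`Σ_{i j i' j'} W i j · W i' j' · [ K(c†_{i'}φ_{κ'.1}, c_i φ_{κ.1}; c_{j'}φ_{κ'.2}, c†_j φ_{κ.2})`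
(both electrons hop `1 → 2`: pair transfer) ` + K(c_{i'}φ_{κ'.1}, c†_i φ_{κ.1}; c†_{j'}φ_{κ'.2},
c_j φ_{κ.2})` (both hop `2 → 1`) ` − K(c_{i'}φ_{κ'.1}, c_i φ_{κ.1}; c†_{j'}φ_{κ'.2}, c†_j φ_{κ.2})`
(out `1 → 2` and back) ` − K(c†_{i'}φ_{κ'.1}, c†_i φ_{κ.1}; c_{j'}φ_{κ'.2}, c_j φ_{κ.2}) ]` (out
`2 → 1` and back), `K = pairResolvent hH E`, where e.g. the first kernel is
`Σ_{μν} ⟨φ_{κ'.1}|c_{i'}|μ⟩⟨μ|c_i|φ_{κ.1}⟩⟨φ_{κ'.2}|c†_{j'}|ν⟩⟨ν|c†_j|φ_{κ.2}⟩/(ε_μ+ε_ν−E)`.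
SIGNS: with cluster-1 orbitals below cluster-2 orbitals, `c'_j = (−1)^{N₁} ⊗ c_j` (Jordan–Wigner
string through cluster 1); for cluster states of a common particle-number parity the two parity
factors of a pair-transfer process differ (`(−1)^{N−1}(−1)^{N−2} = −1`), turning `1/(E−ε_μ−ε_ν)`
into `+1/(ε_μ+ε_ν−E)`, while for an out-and-back process they agree, giving `−1/(ε_μ+ε_ν−E)`
(level repulsion from above). Wrong-sector terms vanish when the `φ`'s are particle-number
eigenstates (`H` conserving `N`). Tsai–Kivelson 2006, App. A (A1)–(A3); Yao–Tsai–Kivelson 2007,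
eq. (2) (`t⁽¹⁾, V⁽¹⁾ = O(t'²)`). [cite: TsaiKivelson2006, App. A (A1)] -/
def interClusterKernel (hH : H.IsHermitian) (φ : K → Fock ι) (W : ι → ι → ℝ) (κ' κ : K × K) : ℂ :=
  ∑ i, ∑ j, ∑ i', ∑ j', ((W i j * W i' j' : ℝ) : ℂ) *
    (pairResolvent hH ((pairEnergy H φ κ + pairEnergy H φ κ') / 2)
        (creation i' *ᵥ φ κ'.1) (annihilation i *ᵥ φ κ.1)
        (annihilation j' *ᵥ φ κ'.2) (creation j *ᵥ φ κ.2) +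
      pairResolvent hH ((pairEnergy H φ κ + pairEnergy H φ κ') / 2)
        (annihilation i' *ᵥ φ κ'.1) (creation i *ᵥ φ κ.1)
        (creation j' *ᵥ φ κ'.2) (annihilation j *ᵥ φ κ.2) -
      pairResolvent hH ((pairEnergy H φ κ + pairEnergy H φ κ') / 2)
        (annihilation i' *ᵥ φ κ'.1) (annihilation i *ᵥ φ κ.1)
        (creation j' *ᵥ φ κ'.2) (creation j *ᵥ φ κ.2) -
      pairResolvent hH ((pairEnergy H φ κ + pairEnergy H φ κ') / 2)
        (creation i' *ᵥ φ κ'.1) (creation i *ᵥ φ κ.1)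
        (annihilation j' *ᵥ φ κ'.2) (annihilation j *ᵥ φ κ.2))

/-- No bonds, no couplings: the kernel vanishes for the zero hopping matrix. [folklore] -/
@[simp] theorem interClusterKernel_zero (hH : H.IsHermitian) (φ : K → Fock ι) (κ' κ : K × K) :
    interClusterKernel hH φ 0 κ' κ = 0 := by
  simp [interClusterKernel]

/-- The inter-cluster kernel is Hermitian: `conj M(κ', κ) = M(κ, κ')` (the reverse of a pair
transfer `1 → 2` is the pair transfer `2 → 1`; out-and-back processes are self-conjugate).
[folklore] -/
theorem star_interClusterKernel (hH : H.IsHermitian) (φ : K → Fock ι) (W : ι → ι → ℝ)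
    (κ' κ : K × K) :
    star (interClusterKernel hH φ W κ' κ) = interClusterKernel hH φ W κ κ' := by
  -- reindexing `(i, j, i', j') ↦ (i', j', i, j)` of a quadruple sum
  have key : ∀ F : ι → ι → ι → ι → ℂ,
      ∑ i, ∑ j, ∑ i', ∑ j', F i j i' j' = ∑ i, ∑ j, ∑ i', ∑ j', F i' j' i j := by
    intro F
    calc ∑ i, ∑ j, ∑ i', ∑ j', F i j i' j' = ∑ i, ∑ i', ∑ j, ∑ j', F i j i' j' :=
          Finset.sum_congr rfl fun i _ => Finset.sum_comm
      _ = ∑ i', ∑ i, ∑ j, ∑ j', F i j i' j' := Finset.sum_comm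
      _ = ∑ i', ∑ i, ∑ j', ∑ j, F i j i' j' :=
          Finset.sum_congr rfl fun i' _ => Finset.sum_congr rfl fun i _ => Finset.sum_comm
      _ = ∑ i', ∑ j', ∑ i, ∑ j, F i j i' j' :=
          Finset.sum_congr rfl fun i' _ => Finset.sum_comm
  unfold interClusterKernel
  simp only [star_sum, star_mul', star_add, star_sub, star_pairResolvent, Complex.star_def,
    Complex.conj_ofReal]
  rw [key]
  refine Finset.sum_congr rfl fun i _ => Finset.sum_congr rfl fun j _ =>
    Finset.sum_congr rfl fun i' _ => Finset.sum_congr rfl fun j' _ => ?_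
  rw [add_comm (pairEnergy H φ κ') (pairEnergy H φ κ), mul_comm (W i' j') (W i j)]
  ring

end InterCluster

/-! ### Pseudospin-1 (pair-boson) bond couplings -/

/-- The `O(t'²)` bond couplings of a three-state (`k = 0, 1, 2` hole pairs ↦ `S^z = k − 1`)
cluster pair boson = pseudospin 1: correlated pair-hopping amplitudes `hA` (`(0,1) → (1,0)`),
`hB` (`(0,2) → (1,1)`), `hB'` (`(1,1) → (2,0)`; equals `hB` for a reflection-symmetric bond) and
`hC` (`(1,2) → (2,1)`), and the diagonal table `V k k'` of second-order shifts of the product state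
`|k, k'⟩` (Yao–Tsai–Kivelson 2007, eq. (2): the `S = 1/2` case `−t⁽¹⁾ b†b + V⁽¹⁾ ρρ`).
[cite: YaoTsaiKivelson2007, eq. (2)] -/
structure PairBosonCouplings where
  /-- amplitude of `|0,1⟩ → |1,0⟩` (hole pairs on the two clusters of the bond) -/
  hA : ℝ
  /-- amplitude of `|0,2⟩ → |1,1⟩` -/
  hB : ℝ
  /-- amplitude of `|1,1⟩ → |2,0⟩` -/
  hB' : ℝ
  /-- amplitude of `|1,2⟩ → |2,1⟩` -/
  hC : ℝ
  /-- diagonal second-order shift of `|k, k'⟩` -/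
  V : Fin 3 → Fin 3 → ℝ

namespace PairBosonCouplings

variable (C : PairBosonCouplings)

/-- The pseudospin value `s_k = k − 1 ∈ {−1, 0, 1}` of the cluster state with `k` hole pairs
(route dictionary: `k` hole pairs ↦ `S^z = k − 1`). [folklore] -/
def spinOf (k : Fin 3) : ℝ := (k : ℝ) - 1

/-- Constant part `c₀ = V(1,1)` of the diagonal table. [folklore] -/
def c0 : ℝ := C.V 1 1

/-- Field-like coefficient `f = (V(2,1) − V(0,1))/2` of `sₙ + sₘ` (a constant in a sector of
fixed total `S^z`). [folklore] -/
def f : ℝ := (C.V 2 1 - C.V 0 1) / 2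

/-- Per-bond single-ion coefficient `g = (V(2,1) + V(0,1) − 2V(1,1))/2` of `sₙ² + sₘ²`: summed over
the bonds at a cluster it gives the `D (S^z)²` term of the pseudospin-1 model (for the square
superlattice of `a × b` clusters, `D_eff = 2 g(horizontal bonds) + 2 g(vertical bonds)`).
[folklore] -/
def g : ℝ := (C.V 2 1 + C.V 0 1 - 2 * C.V 1 1) / 2

/-- Ising coefficient `v = (V(2,2) + V(0,0) − 2V(2,0))/4` of `sₙ sₘ`. [folklore] -/
def v : ℝ := (C.V 2 2 + C.V 0 0 - 2 * C.V 2 0) / 4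

/-- Particle–hole-odd coefficient `w_odd = (V(2,2) − V(0,0))/4 − f` of `sₙ² sₘ + sₙ sₘ²`.
[folklore] -/
def wOdd : ℝ := (C.V 2 2 - C.V 0 0) / 4 - C.f

/-- Biquadratic coefficient `w = V(2,0) + V(1,1) − V(2,1) − V(0,1) + v` of `sₙ² sₘ²`. [folklore] -/
def w : ℝ := C.V 2 0 + C.V 1 1 - C.V 2 1 - C.V 0 1 + C.v

/-- **Six-parameter decomposition of a symmetric diagonal table**: for a symmetric `V`,
`V n m = c₀ + f (sₙ + sₘ) + v sₙ sₘ + g (sₙ² + sₘ²) + w_odd (sₙ² sₘ + sₙ sₘ²) + w sₙ² sₘ²` with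
`s = spinOf` — the pseudospin-1 form (constant, field, Ising `S^zS^z`, single-ion `(S^z)²`,
PH-odd, biquadratic `(S^z)²(S^z)²`) of the diagonal `O(t'²)` couplings. [folklore] -/
theorem table_eq (hV : ∀ n m, C.V n m = C.V m n) (n m : Fin 3) :
    C.V n m = C.c0 + C.f * (spinOf n + spinOf m) + C.v * (spinOf n * spinOf m) +
      C.g * (spinOf n ^ 2 + spinOf m ^ 2) + C.wOdd * (spinOf n ^ 2 * spinOf m + spinOf n * spinOf m ^ 2) +
      C.w * (spinOf n ^ 2 * spinOf m ^ 2) := by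
  have h10 := hV 1 0; have h20 := hV 2 0; have h21 := hV 2 1
  fin_cases n <;> fin_cases m <;>
    simp only [c0, f, g, v, wOdd, w, spinOf, Nat.cast_zero, Nat.cast_one, Nat.cast_ofNat,
      Fin.zero_eta, Fin.mk_one, Fin.reduceFinMk] at * <;> linarith

end PairBosonCouplings

section Hubbard

variable {Λ : Type*} [LinearOrder Λ] [Fintype Λ]
  {H : Matrix (Finset (Orb Λ)) (Finset (Orb Λ)) ℂ}

/-- Spin-diagonal unit hopping on a set `B` of boundary site pairs `(p, q)` (`p` in cluster 1,
`q` in cluster 2): `W (p,σ) (q,σ') = [σ = σ'] [(p,q) ∈ B]`, i.e. the inter-cluster perturbation is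
`V = −t' Σ_{(p,q) ∈ B, σ} (c†_{pσ} c'_{qσ} + h.c.)` with `t' = 1`. [folklore] -/
def bondHopping (B : Finset (Λ × Λ)) (i j : Orb Λ) : ℝ :=
  if (ofLex i).2 = (ofLex j).2 ∧ ((ofLex i).1, (ofLex j).1) ∈ B then 1 else 0

omit [Fintype Λ] in
/-- Without boundary bonds the inter-cluster hopping matrix vanishes. [folklore] -/
@[simp] theorem bondHopping_empty : bondHopping (∅ : Finset (Λ × Λ)) = 0 := by
  funext i j
  simp [bondHopping]

/-- **The `O(t'²)` couplings of cluster pair bosons** (definition request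
`clusterPairBosonCouplings` of route SpinOnePairBoson). Data: a Hermitian cluster Hamiltonian `H`
on `Fock (Orb Λ)` (intended: `−Σ τ(p,q) c†c + U Σ n↑n↓` at a flat cluster point), the three
cluster states `φ 0, φ 1, φ 2` (intended: the normalised unique sector ground states with
`N₁ + 2, N₁, N₁ − 2` electrons = `0, 1, 2` hole pairs, flat: `E₀ + E₂ = 2E₁`, gapped from all
other charge sectors) and the boundary bonds `B`. With `M = interClusterKernel hH φ (bondHopping B)`
(matrix of `V (E − H₀)⁻¹_red V` on the nine product states `|k, k'⟩`, hole pairs on cluster 1 and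
cluster 2, unit inter-cluster hopping): `hA = −Re M((1,0),(0,1))`, `hB = −Re M((1,1),(0,2))`,
`hB' = −Re M((2,0),(1,1))`, `hC = −Re M((2,1),(1,2))`, `V k k' = Re M((k,k'),(k,k'))`, so that the
`O(t'²)` two-cluster effective Hamiltonian has hopping elements `−t'² h` as in the route's
pseudospin-1 dictionary (`⟨1,0|H_S1|0,1⟩ = −2(h + r) = −hA`, `⟨1,1|H_S1|0,2⟩ = −2(h − r) = −hB`,
`⟨2,1|H_S1|1,2⟩ = −2(h + r)`, whence the particle–hole condition `hA = hC`). The pair-hopping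
entries are gauge invariant under `φ_k ↦ e^{iθ_k} φ_k` except `hB, hB'` (phase `θ₀ + θ₂ − 2θ₁`);
for a real (time-reversal symmetric) `H` and real `φ` all entries of `M` are real.
Tsai–Kivelson 2006 App. A; Yao–Tsai–Kivelson 2007 eq. (2) (`S = 1/2` analogue).
[cite: YaoTsaiKivelson2007, eq. (2)] -/
def clusterPairBosonCouplings (hH : H.IsHermitian) (φ : Fin 3 → Fock (Orb Λ)) (B : Finset (Λ × Λ)) :
    PairBosonCouplings where
  hA := -(interClusterKernel hH φ (bondHopping B) (1, 0) (0, 1)).re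
  hB := -(interClusterKernel hH φ (bondHopping B) (1, 1) (0, 2)).re
  hB' := -(interClusterKernel hH φ (bondHopping B) (2, 0) (1, 1)).re
  hC := -(interClusterKernel hH φ (bondHopping B) (2, 1) (1, 2)).re
  V k k' := (interClusterKernel hH φ (bondHopping B) (k, k') (k, k')).re

/-- The diagonal table of `clusterPairBosonCouplings` is symmetric under exchanging the two
clusters' occupations whenever the kernel is (e.g. for a reflection-symmetric bond set); in
general it is the real part of a Hermitian kernel's diagonal, `V k k' = M((k,k'),(k,k'))`
(real). [folklore] -/
theorem clusterPairBosonCouplings_V_eq (hH : H.IsHermitian) (φ : Fin 3 → Fock (Orb Λ))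
    (B : Finset (Λ × Λ)) (k k' : Fin 3) :
    ((clusterPairBosonCouplings hH φ B).V k k' : ℂ) =
      interClusterKernel hH φ (bondHopping B) (k, k') (k, k') := by
  refine Complex.ext rfl ?_
  have h := star_interClusterKernel hH φ (bondHopping B) (k, k') (k, k')
  rw [Complex.star_def] at h
  have him := congrArg Complex.im h
  rw [Complex.conj_im] at him
  simp only [clusterPairBosonCouplings, Complex.ofReal_im]
  linarith

end Hubbard

end Literature.MathematicalPhysics.QuantumLattice
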